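import Mathlib
import Summits.Ventures.PercRepro2.LocRows
import Summits.Ventures.PercRepro2.SwRow
import Summits.Ventures.PercRepro2.SwOut
import Summits.Ventures.PercRepro2.SwAllRow
import Summits.Ventures.PercRepro2.SwOutAll
import Summits.Ventures.PercRepro2.SwOutArmFlip
import Summits.Ventures.PercRepro2.SwOutArms
import Summits.Ventures.PercRepro2.SwOutArmOrbit
import Summits.Ventures.PercRepro2.SwOutArmCube
import Summits.Ventures.PercRepro2.SwOutArmThm
import Summits.Ventures.PercRepro2.SwOutCoreDefs
import Summits.Ventures.PercRepro2.SwOutCoreCube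
import Summits.Ventures.PercRepro2.SwOutShadowDefs
import Summits.Ventures.PercRepro2.SwOutShadowCube
import Summits.Ventures.PercRepro2.SwOutCoreShadowDefs
import Summits.Ventures.PercRepro2.SwOutCoreShadowKey
import Summits.Ventures.PercRepro2.SwOutCoreShadowKind
import Summits.Ventures.PercRepro2.SwOutJunctionH1Defs
import Summits.Ventures.PercRepro2.SwOutJunctionH1Kinds
import Summits.Ventures.PercRepro2.SwOutJunctionH1Orbit
import Summits.Ventures.PercRepro2.SwOutJunctionH1Key
import Summits.Ventures.PercRepro2.SwOutJunctionH1BundleDefs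
import Summits.Ventures.PercRepro2.SwOutJunctionH1BundleLift

/-!
# The bundle `h–u` by subdivision: every block of a uniform point is uniform (blind cell PercRepro2,
night-4 g29, 2026-08-28; proofs/NIGHT4-G29.md §9)

The bundle version of `SwOutJunctionH1EdgeUniform`: a configuration of `G⁺` is UNIFORM when every
`h–w_b` and `w_b–u` have the same colour (`BUniform`).  Every move of g14's block decomposition is
the flip of a vertex set `S` with `h ∉ S` and `u ∈ S → every w_b ∈ S` (the arm of each `w_b` is a
u-adjacent h-arm, red at every one-sided point), the shadow recolouring misses the `w_b`, and the
bases are uniform by the `CoreBase` fields; so uniformity is preserved along every block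
(`buniform_orbitReal`, `buniform_coreReal`, `buniform_shadowReal`) and **every block of a uniform
`Q`-point of a class of `G⁺` consists of uniform points** (`buniform_of_mem_blockOf`) — including
the out kind, which occurs when the bundle is empty.
-/

namespace Summit.Ventures.PercRepro2

namespace LocRows

open Hull

variable {V : Type*} {E : Type*} [Fintype E] [DecidableEq E]

open scoped Classical

/-- A configuration of `G⁺` is uniform when every `h–w_b` and `w_b–u` have the same colour. -/
def BUniform {ends : E → Sym2 V} {h u : V} (ζ : Config (E ⊕ (Bundle ends h u × Bool))) : Prop :=
  ∀ b : Bundle ends h u, ζ (Sum.inl b.1) = ζ (Sum.inr (b, false))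

section Basic

variable {ends : E → Sym2 V} {h u l : V}

omit [Fintype E] [DecidableEq E] in
/-- The uniform lift is uniform. -/
lemma buniform_blift (ζ : Config E) : BUniform (blift (ends := ends) (h := h) (u := u) ζ) :=
  fun _ => rfl

omit [Fintype E] [DecidableEq E] in
/-- The colour swap preserves uniformity. -/
lemma buniform_blue {ζ : Config (E ⊕ (Bundle ends h u × Bool))} (hζ : BUniform ζ) :
    BUniform (blue ζ) := by
  intro b
  simp only [blue_apply, hζ b]

omit [Fintype E] [DecidableEq E] in
/-- The edge `h–w_b` touches `S` iff `h` or `w_b` is in `S`. -/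
lemma inl_bundle_mem_touches_iff {S : Set (V ⊕ Bundle ends h u)} (b : Bundle ends h u) :
    Sum.inl b.1 ∈ touches (bundEnds ends h u l) S ↔ Sum.inl h ∈ S ∨ Sum.inr b ∈ S :=
  mem_touches_iff_of_ends (bundEnds_inl_bundle b)

omit [Fintype E] [DecidableEq E] in
/-- The edge `w_b–u` touches `S` iff `w_b` or `u` is in `S`. -/
lemma inr_bfalse_mem_touches_iff {S : Set (V ⊕ Bundle ends h u)} (b : Bundle ends h u) :
    Sum.inr (b, false) ∈ touches (bundEnds ends h u l) S ↔ Sum.inr b ∈ S ∨ Sum.inl u ∈ S :=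
  mem_touches_iff_of_ends (bundEnds_inr_false b)

omit [Fintype E] [DecidableEq E] in
/-- **The flip of a set `S` with `h ∉ S` and `u ∈ S → every w_b ∈ S` preserves uniformity**: each pair
`h–w_b`, `w_b–u` flips together (both iff `w_b ∈ S`). -/
theorem buniform_flip {S : Set (V ⊕ Bundle ends h u)} (hh : Sum.inl h ∉ S)
    (huw : Sum.inl u ∈ S → ∀ b : Bundle ends h u, Sum.inr b ∈ S)
    {ζ : Config (E ⊕ (Bundle ends h u × Bool))} (hζ : BUniform ζ) :
    BUniform (flip (bundEnds ends h u l) S ζ) := by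
  intro b
  by_cases hw : (Sum.inr b : V ⊕ Bundle ends h u) ∈ S
  · rw [flip_apply_of_mem ((inl_bundle_mem_touches_iff b).2 (Or.inr hw)),
      flip_apply_of_mem ((inr_bfalse_mem_touches_iff b).2 (Or.inl hw)), hζ b]
  · rw [flip_apply_of_notMem, flip_apply_of_notMem, hζ b]
    · rw [inr_bfalse_mem_touches_iff]
      rintro (h1 | h1)
      · exact hw h1
      · exact hw (huw h1 b)
    · rw [inl_bundle_mem_touches_iff]
      rintro (h1 | h1)
      · exact hh h1
      · exact hw h1

omit [Fintype E] [DecidableEq E] in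
/-- Every `w_b` lies in the hull of `h` of every configuration. -/
lemma inr_mem_hull (ζ : Config (E ⊕ (Bundle ends h u × Bool))) (b : Bundle ends h u) :
    Sum.inr b ∈ hull (bundEnds ends h u l) ζ (Sum.inl h) := by
  cases hc : ζ (Sum.inl b.1)
  · right
    exact mem_cluster_of_edge (e := Sum.inl b.1) (mem_cluster_self _ _ _)
      (by rw [blue_eq_true_iff]; exact hc) (bundEnds_inl_bundle b)
  · left
    exact mem_cluster_of_edge (e := Sum.inl b.1) (mem_cluster_self _ _ _) hc (bundEnds_inl_bundle b)

omit [Fintype E] [DecidableEq E] in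
/-- With a bundle edge present, `u` lies in the hull of `h` of every uniform configuration
(through `w_b`). -/
lemma inl_u_mem_hull_of_buniform {ζ : Config (E ⊕ (Bundle ends h u × Bool))} (hζ : BUniform ζ)
    (b : Bundle ends h u) : Sum.inl u ∈ hull (bundEnds ends h u l) ζ (Sum.inl h) := by
  cases hc : ζ (Sum.inl b.1)
  · right
    have hw : Sum.inr b ∈ cluster (bundEnds ends h u l) (blue ζ) (Sum.inl h) :=
      mem_cluster_of_edge (e := Sum.inl b.1) (mem_cluster_self _ _ _)
        (by rw [blue_eq_true_iff]; exact hc) (bundEnds_inl_bundle b)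
    exact mem_cluster_of_edge (e := Sum.inr (b, false)) hw
      (by rw [blue_eq_true_iff]; exact (hζ b).symm.trans hc) (bundEnds_inr_false b)
  · left
    have hw : Sum.inr b ∈ cluster (bundEnds ends h u l) ζ (Sum.inl h) :=
      mem_cluster_of_edge (e := Sum.inl b.1) (mem_cluster_self _ _ _) hc (bundEnds_inl_bundle b)
    exact mem_cluster_of_edge (e := Sum.inr (b, false)) hw ((hζ b).symm.trans hc)
      (bundEnds_inr_false b)

omit [Fintype E] [DecidableEq E] in
/-- **The all-red orientation of a uniform core-free configuration is uniform**: the flipped set is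
the blue cluster minus `h`, and `u` in it forces every `w_b` in it (else `u` would be a core). -/
theorem buniform_allRed (hhu : h ≠ u) {ζ : Config (E ⊕ (Bundle ends h u × Bool))} (hζ : BUniform ζ)
    (hc : CoreFree (bundEnds ends h u l) ζ (Sum.inl h)) :
    BUniform (allRed (bundEnds ends h u l) ζ (Sum.inl h)) := by
  unfold allRed
  refine buniform_flip (by simp) ?_ hζ
  rintro ⟨huT', -⟩ b
  refine ⟨?_, by simp⟩
  cases hcol : ζ (Sum.inr (b, false))
  · exact mem_cluster_of_edge (e := Sum.inr (b, false)) huT' (by rw [blue_eq_true_iff]; exact hcol)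
      (by rw [bundEnds_inr_false, Sym2.eq_swap])
  · exfalso
    have hhw : ζ (Sum.inl b.1) = true := (hζ b).trans hcol
    have hwT : Sum.inr b ∈ cluster (bundEnds ends h u l) ζ (Sum.inl h) :=
      mem_cluster_of_edge (e := Sum.inl b.1) (mem_cluster_self _ _ _) hhw (bundEnds_inl_bundle b)
    have huT : Sum.inl u ∈ cluster (bundEnds ends h u l) ζ (Sum.inl h) :=
      mem_cluster_of_edge (e := Sum.inr (b, false)) hwT hcol (bundEnds_inr_false b)
    exact hhu (Sum.inl_injective (hc (Sum.inl u) huT huT')).symm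

omit [DecidableEq E] in
/-- **Every point of the coarse orbit of a uniform core-free configuration is uniform**: the arms
flipped are unions of components of `G⁺[H ∖ {h}]`, and `u` and every `w_b` share their component. -/
theorem buniform_orbitReal (hhu : h ≠ u) {ρ : Config (E ⊕ (Bundle ends h u × Bool))}
    (hρ : BUniform ρ) (hc : CoreFree (bundEnds ends h u l) ρ (Sum.inl h))
    (ω : Config (arms (bundEnds ends h u l) ρ (Sum.inl h))) :
    BUniform (orbitReal (bundEnds ends h u l) ρ (Sum.inl h) ω) := by
  unfold orbitReal
  refine buniform_flip ?_ ?_ (buniform_allRed hhu hρ hc)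
  · intro hh
    exact (mem_hull_sdiff_of_mem_armsFalse hh).2 rfl
  · intro hu b
    have huH : Sum.inl u ∈ hull (bundEnds ends h u l) ρ (Sum.inl h) :=
      (mem_hull_sdiff_of_mem_armsFalse hu).1
    obtain ⟨P, hP, huP⟩ := hu
    refine ⟨P, hP, ?_⟩
    obtain ⟨e, he, hPe⟩ := Finset.mem_image.1 P.2
    rw [← hPe] at huP ⊢
    obtain ⟨y, hy, hyh, huy⟩ := huP
    refine ⟨y, hy, hyh, ?_⟩
    refine mem_cluster_of_edge (e := Sum.inr (b, false)) huy ?_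
      (by rw [bundEnds_inr_false, Sym2.eq_swap])
    rw [armConfig_eq_true_iff]
    refine ⟨Sum.inr b, ⟨inr_mem_hull ρ b, by simp⟩, Sum.inl u, ⟨huH, ?_⟩, bundEnds_inr_false b⟩
    simp only [Set.mem_singleton_iff, Sum.inl.injEq]
    exact fun h' => hhu h'.symm

end Basic

/-! ## The core cubes and the shadow blocks -/

section Blocks

variable {ends : E → Sym2 V} {h u l : V}

omit [Fintype E] [DecidableEq E] in
/-- A core base of `G⁺` with junction `u` is uniform: its `h`-edges and `u`-edges are red. -/
lemma buniform_of_coreBase {ι : Type*} {A : ι → Set (V ⊕ Bundle ends h u)} {pure : ι → Prop}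
    {b : Config (E ⊕ (Bundle ends h u × Bool))} {H : Set (V ⊕ Bundle ends h u)}
    (hb : CoreBase (bundEnds ends h u l) b (Sum.inl h) (Sum.inl u) H A pure) : BUniform b := by
  intro c
  rw [hb.h_red (Sum.inl c.1) (Sum.inr c) (bundEnds_inl_bundle c),
    hb.u_red (Sum.inr (c, false)) (Sum.inr c) (by rw [bundEnds_inr_false, Sym2.eq_swap])]

omit [Fintype E] [DecidableEq E] in
/-- **Every point of a core cube of `G⁺` is uniform**: the arms avoid `h` and `u`. -/
theorem buniform_coreReal {ι : Type*} {A : ι → Set (V ⊕ Bundle ends h u)} {pure : ι → Prop}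
    {b : Config (E ⊕ (Bundle ends h u × Bool))} {H : Set (V ⊕ Bundle ends h u)}
    (hb : CoreBase (bundEnds ends h u l) b (Sum.inl h) (Sum.inl u) H A pure) (ω : Config ι) :
    BUniform (coreReal (bundEnds ends h u l) A b ω) := by
  unfold coreReal
  refine buniform_flip ?_ ?_ (buniform_of_coreBase hb)
  · rintro ⟨i, _, hi⟩
    exact (hb.arm_sub i _ hi).2.1 rfl
  · rintro ⟨i, _, hi⟩
    exact absurd rfl (hb.arm_sub i _ hi).2.2

omit [Fintype E] [DecidableEq E] in
/-- The arm of `w_b` in a core base of `G⁺` is not pure (it carries the edge `h–w_b`). -/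
lemma not_pureC_of_inr_mem {P : Set (V ⊕ Bundle ends h u)} {b : Bundle ends h u}
    (hw : Sum.inr b ∈ P) : ¬ pureC (bundEnds ends h u l) (Sum.inl h) P :=
  fun hp => hp (Sum.inl b.1) (Sum.inr b) (bundEnds_inl_bundle b) hw

omit [Fintype E] [DecidableEq E] in
/-- The arm of `w_b` is adjacent to `u` (the edge `w_b–u`). -/
lemma uAdjC_of_inr_mem {ι : Type*} {A : ι → Set (V ⊕ Bundle ends h u)} {i : ι} {b : Bundle ends h u}
    (hw : Sum.inr b ∈ A i) : uAdjC (bundEnds ends h u l) (Sum.inl u) A i :=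
  ⟨Sum.inr (b, false), Sum.inr b, by rw [bundEnds_inr_false, Sym2.eq_swap], hw⟩

/-- At the one-sided point of shadow data, the arm of `w_b` is red: a blue u-adjacent h-arm would
make `u` red at the flipped point. -/
lemma omegaSR_eq_true_of_inr_mem {U' : Set (V ⊕ Bundle ends h u)}
    {ξ' : Config (E ⊕ (Bundle ends h u × Bool))} {b : Config (E ⊕ (Bundle ends h u × Bool))}
    {S R : Finset (Set (V ⊕ Bundle ends h u))}
    (hd : ShadowData (bundEnds ends h u l) U' ξ' (Sum.inl h) (Sum.inl u) b S R) {P : S}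
    {c : Bundle ends h u} (hw : Sum.inr c ∈ P.1) : omegaSR S R P = true := by
  by_contra hP
  simp only [Bool.not_eq_true] at hP
  apply hd.huB
  refine ⟨P, by simp [flipAll, hP], not_pureC_of_inr_mem hw, Sum.inr (c, false), Sum.inr c,
    by rw [bundEnds_inr_false, Sym2.eq_swap], hw⟩

/-- No `w_b` is a dropped vertex of shadow data. -/
lemma inr_notMem_sZ {U' : Set (V ⊕ Bundle ends h u)} {ξ' : Config (E ⊕ (Bundle ends h u × Bool))}
    {b : Config (E ⊕ (Bundle ends h u × Bool))} {S R : Finset (Set (V ⊕ Bundle ends h u))}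
    (hd : ShadowData (bundEnds ends h u l) U' ξ' (Sum.inl h) (Sum.inl u) b S R)
    (c : Bundle ends h u) :
    Sum.inr c ∉ sZ (bundEnds ends h u l) (Sum.inl u) (armsFun S) (omegaSR S R) := by
  rintro ⟨P, _, hP, hw⟩
  have := omegaSR_eq_true_of_inr_mem hd hw
  rw [hP] at this
  exact absurd this (by decide)

/-- Every `w_b` lies in the coarse arm `sX` of shadow data. -/
lemma inr_mem_sX {U' : Set (V ⊕ Bundle ends h u)} {ξ' : Config (E ⊕ (Bundle ends h u × Bool))}
    {b : Config (E ⊕ (Bundle ends h u × Bool))} {S R : Finset (Set (V ⊕ Bundle ends h u))}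
    (hd : ShadowData (bundEnds ends h u l) U' ξ' (Sum.inl h) (Sum.inl u) b S R)
    (c : Bundle ends h u) :
    Sum.inr c ∈ sX (bundEnds ends h u l) (Sum.inl u) (armsFun S) (omegaSR S R) := by
  have hwH : Sum.inr c ∈ extHull (bundEnds ends h u l) b (Sum.inl h) (Sum.inl u) :=
    Or.inl (inr_mem_hull b c)
  obtain ⟨P, hP⟩ := hd.hb.arm_cover (Sum.inr c) hwH (by simp) (by simp)
  rw [mem_sX_iff]
  exact Or.inr ⟨P, uAdjC_of_inr_mem hP, omegaSR_eq_true_of_inr_mem hd hP, hP⟩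

/-- The shadow base of shadow data of `G⁺` is uniform: the recoloured edges join `u` to the dropped
arms, and no `w_b` is dropped. -/
lemma buniform_shadowOf {U' : Set (V ⊕ Bundle ends h u)} {ξ' : Config (E ⊕ (Bundle ends h u × Bool))}
    {b : Config (E ⊕ (Bundle ends h u × Bool))} {S R : Finset (Set (V ⊕ Bundle ends h u))}
    (hd : ShadowData (bundEnds ends h u l) U' ξ' (Sum.inl h) (Sum.inl u) b S R) :
    BUniform (shadowOf (bundEnds ends h u l) (Sum.inl u) (armsFun S) (omegaSR S R) b) := by
  have hb := buniform_of_coreBase hd.hb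
  intro c
  rw [shadowOf_apply_of_not, shadowOf_apply_of_not, hb c]
  · rintro ⟨z, hz, hez⟩
    rw [bundEnds_inr_false, Sym2.eq_iff] at hez
    rcases hez with ⟨h1, _⟩ | ⟨h1, _⟩
    · exact absurd h1 (by simp)
    · exact inr_notMem_sZ hd c (h1 ▸ hz)
  · rintro ⟨z, _, hez⟩
    rw [bundEnds_inl_bundle, Sym2.eq_iff] at hez
    rcases hez with ⟨h1, _⟩ | ⟨_, h2⟩
    · exact hd.hb.hne h1
    · exact absurd h2 (by simp)

/-- **Every point of the shadow block of shadow data of `G⁺` is uniform**: the flipped sets are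
the coarse arm `sX` (which contains every `w_b` with `u`), far arms and dropped arms (which avoid
`u` and the `w_b`). -/
theorem buniform_shadowReal {U' : Set (V ⊕ Bundle ends h u)}
    {ξ' : Config (E ⊕ (Bundle ends h u × Bool))} {b : Config (E ⊕ (Bundle ends h u × Bool))}
    {S R : Finset (Set (V ⊕ Bundle ends h u))}
    (hd : ShadowData (bundEnds ends h u l) U' ξ' (Sum.inl h) (Sum.inl u) b S R)
    (ω' : Config (Option {i : S // ¬ uAdjC (bundEnds ends h u l) (Sum.inl u) (armsFun S) i})) :
    BUniform (shadowReal (bundEnds ends h u l)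
      (sB (bundEnds ends h u l) (Sum.inl u) (armsFun S) (omegaSR S R))
      (sZ (bundEnds ends h u l) (Sum.inl u) (armsFun S) (omegaSR S R)) none
      (shadowOf (bundEnds ends h u l) (Sum.inl u) (armsFun S) (omegaSR S R) b) ω') := by
  unfold shadowReal
  refine buniform_flip ?_ ?_ (buniform_shadowOf hd)
  · rintro (⟨j, _, hj⟩ | ⟨_, hZ⟩)
    · rcases j with _ | i
      · rcases (mem_sX_iff).1 hj with h1 | ⟨P, _, _, hP⟩
        · exact hd.hb.hne h1
        · exact (hd.hb.arm_sub P _ hP).2.1 rfl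
      · exact (hd.hb.arm_sub i.1 _ hj).2.1 rfl
    · obtain ⟨P, _, _, hP⟩ := (mem_sZ_iff).1 hZ
      exact (hd.hb.arm_sub P _ hP).2.1 rfl
  · rintro (⟨j, hωj, hj⟩ | ⟨_, hZ⟩) c
    · rcases j with _ | i
      · exact Or.inl ⟨none, hωj, inr_mem_sX hd c⟩
      · exact absurd rfl (hd.hb.arm_sub i.1 _ hj).2.2
    · obtain ⟨P, _, _, hP⟩ := (mem_sZ_iff).1 hZ
      exact absurd rfl (hd.hb.arm_sub P _ hP).2.2

end Blocks

/-! ## The blocks of a uniform point -/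

section Main

variable {ends : E → Sym2 V} {h u l o : V} {U' : Set (V ⊕ Bundle ends h u)}
  {ξ' : Config (E ⊕ (Bundle ends h u × Bool))}

variable (hl : Sum.inl l ∉ U') (hhu : h ≠ u)
  (hloop_h : ∀ e, bundEnds ends h u l e ≠ s(Sum.inl h, Sum.inl h))
  (hloop_u : ∀ e, bundEnds ends h u l e ≠ s(Sum.inl u, Sum.inl u))
  (hnadj : ∀ e, bundEnds ends h u l e ≠ s(Sum.inl h, Sum.inl u))
  (hout : ∀ x ∈ U', x ≠ Sum.inl h → x ≠ Sum.inl o → x ≠ Sum.inl u →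
    (∃ e y, bundEnds ends h u l e = s(x, y) ∧ y ∉ U') ∨ (∀ e, x ∉ bundEnds ends h u l e))
  (hH1 : H1 (bundEnds ends h u l) U' (Sum.inl h) (Sum.inl u))
include hl hhu hloop_h hloop_u hnadj hout hH1

/-- **Every block of a uniform `Q`-point of a class of `G⁺` consists of uniform points.** -/
theorem buniform_of_mem_blockOf {ζ : Config (E ⊕ (Bundle ends h u × Bool))}
    (hζ : ζ ∈ swOutSide (bundEnds ends h u l) (Sum.inl l) (Sum.inl h) (Sum.inl o) U' ξ')
    (hun : BUniform ζ) {ζ' : Config (E ⊕ (Bundle ends h u × Bool))}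
    (hζ' : ζ' ∈ blockOf (bundEnds ends h u l) (Sum.inl h) (Sum.inl u)
      (keyOf (bundEnds ends h u l) U' ξ' (Sum.inl h) (Sum.inl u) ζ)) : BUniform ζ' := by
  have hhu' : (Sum.inl h : V ⊕ Bundle ends h u) ≠ Sum.inl u := fun h' => hhu (Sum.inl_injective h')
  by_cases hu : Sum.inl u ∉ hull (bundEnds ends h u l) ζ (Sum.inl h)
  · -- the out kind (the bundle is empty): the coarse orbit of a core-free point
    rw [keyOf_of_out hu] at hζ'
    have hc : CoreFree (bundEnds ends h u l) ζ (Sum.inl h) := coreFree_of_u_notMem_hull hout hζ hu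
    simp only [blockOf, orbit, Finset.mem_image, Finset.mem_univ, true_and] at hζ'
    obtain ⟨ω, rfl⟩ := hζ'
    exact buniform_orbitReal hhu (buniform_allRed hhu hun hc) (coreFree_allRed hc) ω
  rw [not_not] at hu
  by_cases hk : hull (bundEnds ends h u l) ζ (Sum.inl u) ⊆ U'
  · rw [keyOf_of_coreKind hu hk] at hζ'
    have hb := coreBase_of_coreKind hl hhu' hloop_h hloop_u hnadj hout hH1 hζ ⟨hu, hk⟩
    obtain ⟨ω, rfl⟩ := (mem_coreCube).1 hζ'
    exact buniform_coreReal hb ω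
  by_cases hs : ShadowKind (bundEnds ends h u l) U' ξ' (Sum.inl h) (Sum.inl u) ζ
  · rw [keyOf_of_shadowKind hu hk hs] at hζ'
    simp only [blockOf, shadowBlock] at hζ'
    obtain ⟨ω', rfl⟩ := (mem_shadowCube).1 hζ'
    exact buniform_shadowReal hs.1 ω'
  · rw [keyOf_of_plain hu hk hs] at hζ'
    have hc : CoreFree (bundEnds ends h u l) ζ (Sum.inl h) := coreFree_of_escaping hout hζ hk
    simp only [blockOf, orbit, Finset.mem_image, Finset.mem_univ, true_and] at hζ'
    obtain ⟨ω, rfl⟩ := hζ'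
    exact buniform_orbitReal hhu (buniform_allRed hhu hun hc) (coreFree_allRed hc) ω

end Main

end LocRows

end Summit.Ventures.PercRepro2
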